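import Summits.AnomalousDissipation.AnomalousDissipation.Theorems.ResolvedDissipation.Negative.ShearMode

/-!
# Negative knowledge for the crux `MomentParity.ResolvedDissipation` (stmt-AnomalousDissipation-14284):
# II — load-bearing hypotheses and no force-uniform schedule

Certified copy of §2 and §4 of the cdisprove work file `Cruxes/ResolvedDissipation/Disproof.lean`
(refuter-cdisprove-stmt-AnomalousDissipation-14284-0, cycle 1). Supports stmt-AnomalousDissipation-14284; no
positive route-item statement is asserted; the refuted weakenings/strengthening are stated INLINE (no named facts).

One witness serves throughout: the Dirac law at the shear mode `K_{M,1}` of `Negative/ShearMode`, `M = κ 0 + 1`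
(energy `1/2`, enstrophy `2π²M²` on the shell `M`, `P_{κ 0} K_M = 0`): `not_isResolved_dirac_shearState`.
* `resolvedDissipation_false_without_nu_pos` — `0 < ν` weakened to `0 ≤ ν` is FALSE (`ν = 0`, `f = 0`: free
  shear modes are steady for every Galerkin–Euler truncation).
* `resolvedDissipation_false_without_stationarity` — dropping the generator rows is FALSE.
* `resolvedDissipation_false_without_level` — dropping the carrier clause on `μ` (tests still band-limited) is
  FALSE: at `f = 0`, level `0 < M`, the decaying mode `δ_{K_M}` passes every level-`0` row.
* `not_resolvedDissipationUniformInForce` — no schedule is uniform over smooth forces at fixed `(ν, R)`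
  (laminar single-mode steady states `K_{M,1}` at force `4π²νM²K_{M,1}`): `κ` must see the spectral tail of `f`.
-/

noncomputable section

-- `Summit.<Summit>.<Problem>` is the tree's mandated summit-side namespace (CONVENTIONS §2); for this
-- single-conjunct summit the two segments coincide, so the duplicate is deliberate.
set_option linter.dupNamespace false

namespace Summit.AnomalousDissipation.AnomalousDissipation.Theorems.ResolvedDissipation.Negative

open MeasureTheory Filter Topology
open scoped ENNReal InnerProductSpace RealInnerProductSpace
open Literature.Analysis.FunctionSpaces Literature.Analysis.FluidPDE
open Summit.AnomalousDissipation.AnomalousDissipation.Theses.MomentParity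
open Summit.AnomalousDissipation.AnomalousDissipation.Theorems.QuarticGate.Negative

/-- Local notation for the real Hilbert space `L²(T³; ℝ³)`. -/
local notation "L2T3" => Lp (EuclideanSpace ℝ (Fin 3)) 2 (volume : Measure (UnitAddTorus (Fin 3)))

/-! ## §2 Load-bearing hypotheses: each of `0 < ν`, stationarity, the level clause is NECESSARY

Witness for all three: the Dirac law at the shear mode one shell above the first cutoff `κ 0`. -/

section LoadBearing

/-- Constant fields are divergence free. [folklore] -/
theorem isDivFree_const (a : R3) : Torus.IsDivFree (fun _ : T3 => a) := by
  intro x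
  simp [Torus.divergence, Torus.partialDeriv, Torus.lineDeriv]

/-- The zero force is divergence free. [folklore] -/
theorem isDivFree_zero : Torus.IsDivFree (0 : T3 → R3) := isDivFree_const (0 : R3)

/-- The zero force is smooth. [folklore] -/
theorem isSmooth_zero : Torus.IsSmooth (0 : T3 → R3) := Torus.isSmooth_const (0 : R3)

/-- The zero force has zero mean. [folklore] -/
theorem hasZeroMean_zero : Torus.HasZeroMean (0 : T3 → R3) := by
  simp [Torus.HasZeroMean]

/-- Frequencies with `N² < |k|²` are off the punctured ball of radius `N`. [folklore] -/
theorem not_mem_puncturedBall_of_lt {N : ℕ} {k : Fin 3 → ℤ} (hk : ((N : ℝ)) ^ 2 < Torus.freqNormSq k) :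
    k ∉ (Torus.freqBall N).erase (0 : Fin 3 → ℤ) := fun h =>
  absurd (Torus.mem_freqBall.1 (Finset.mem_erase.1 h).2) (not_le.2 hk)

/-- The modes `±M e₁` are off the punctured ball of every radius `N < M`. [folklore] -/
theorem not_mem_puncturedBall_of_mem_shearSet {N M : ℕ} (hNM : N < M) {k : Fin 3 → ℤ} (hk : k ∈ shearSet M) :
    k ∉ (Torus.freqBall N).erase (0 : Fin 3 → ℤ) := by
  refine not_mem_puncturedBall_of_lt ?_
  rw [freqNormSq_of_mem_shearSet hk]
  have : (N : ℝ) < M := by exact_mod_cast hNM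
  nlinarith [(Nat.cast_nonneg N : (0 : ℝ) ≤ N)]

/-- **Band-limited fields are closed under finite linear combinations** (coefficientwise): if every
`ĝᵢ(k) = 0` then `𝓕(Σᵢ cᵢ gᵢ)(k) = 0`. [folklore] -/
theorem mFourierCoeff_sum_smul_eq_zero {m : ℕ} {g : Fin m → T3 → R3} (hg : ∀ i, Torus.IsSmooth (g i))
    (c : Fin m → ℝ) {k : Fin 3 → ℤ}
    (hk : ∀ i, UnitAddTorus.mFourierCoeff (EuclideanSpace.complexify ∘ g i) k = 0) :
    UnitAddTorus.mFourierCoeff (EuclideanSpace.complexify ∘ fun x => ∑ i, c i • g i x) k = 0 := by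
  have h1 : (EuclideanSpace.complexify ∘ fun x => ∑ i, c i • g i x) =
      fun x => ∑ i, (((c i : ℝ) : ℂ) • (EuclideanSpace.complexify ∘ g i)) x := by
    funext x
    simp only [Function.comp_apply, map_sum, LinearIsometry.map_smul, Pi.smul_apply, Complex.coe_smul]
  rw [h1, Torus.mFourierCoeff_finset_sum _ fun i _ =>
    ((EuclideanSpace.complexify.continuous.comp (hg i).continuous).const_smul ((c i : ℝ) : ℂ)).integrable_unitAddTorus]
  refine Finset.sum_eq_zero fun i _ => ?_
  rw [Torus.mFourierCoeff_const_smul, hk i, smul_zero]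

/-- The differential field `∇p(u)` of a polynomial observable with level-`N` band tests has no mode off
the punctured ball. [folklore] -/
theorem mFourierCoeff_polyGrad_eq_zero {N m : ℕ} {g : Fin m → T3 → R3} (hg : ∀ i, IsBandTest N (g i))
    (P : MvPolynomial (Fin m) ℝ) (u : H3) {k : Fin 3 → ℤ} (hk : k ∉ (Torus.freqBall N).erase (0 : Fin 3 → ℤ)) :
    UnitAddTorus.mFourierCoeff (EuclideanSpace.complexify ∘ polyGrad g P u) k = 0 :=
  mFourierCoeff_sum_smul_eq_zero (fun i => (hg i).1) _ fun i => (hg i).2.2.2 k hk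

/-- **The free shear Dirac is stationary for Galerkin EULER at every level** (`ν = 0`, `f = 0`). [folklore] -/
theorem isStationary_dirac_shearState_euler {M : ℕ} (hM : M ≠ 0) (a : ℝ) (N : ℕ) :
    IsStationary 0 0 N (Measure.dirac (shearState M hM a)) := by
  haveI : MeasurableSingletonClass H3 := OpensMeasurableSpace.toMeasurableSingletonClass
  intro m g P hg
  refine ⟨Torus.integrable_dirac _ _, ?_⟩
  rw [integral_dirac]
  exact nsGeneratorPairing_shearField_euler (coe_shearState_ae hM a)
    (Torus.isSmooth_sum_smul Finset.univ _ fun i _ => (hg i).1)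

/-- **The decaying shear Dirac above the level is stationary at zero force, ANY viscosity**: for `N < M`
no level-`N` observable sees the mode `K_{M,a}` (`δ_{K_{M,a}}` is NOT invariant for `ν > 0` — it decays —
but it is invisible: the level clause on `μ` is what ties the law to the tests). [folklore] -/
theorem isStationary_dirac_shearState_of_lt {M : ℕ} (hM : M ≠ 0) (a ν : ℝ) {N : ℕ} (hNM : N < M) :
    IsStationary ν 0 N (Measure.dirac (shearState M hM a)) := by
  haveI : MeasurableSingletonClass H3 := OpensMeasurableSpace.toMeasurableSingletonClass
  intro m g P hg
  refine ⟨Torus.integrable_dirac _ _, ?_⟩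
  rw [integral_dirac]
  exact nsGeneratorPairing_shearField_of_coeff_eq_zero (coe_shearState_ae hM a)
    (Torus.isSmooth_sum_smul Finset.univ _ fun i _ => (hg i).1)
    fun k hk => mFourierCoeff_polyGrad_eq_zero hg P _ (not_mem_puncturedBall_of_mem_shearSet hNM hk)

/-- The Dirac law at `K_{M,a}` is carried by level-`N` fields, `M ≤ N`. [folklore] -/
theorem ae_isLevel_dirac_shearState {M : ℕ} (hM : M ≠ 0) (a : ℝ) {N : ℕ} (hMN : M ≤ N) :
    ∀ᵐ u ∂(Measure.dirac (shearState M hM a)), IsLevel N u := by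
  haveI : MeasurableSingletonClass H3 := OpensMeasurableSpace.toMeasurableSingletonClass
  rw [ae_dirac_eq]
  simpa using isLevel_shearState hM a hMN

/-- The Dirac law at `K_{M,1}` is supported in the unit ball of `H`. [folklore] -/
theorem ae_norm_le_dirac_shearState {M : ℕ} (hM : M ≠ 0) :
    ∀ᵐ u ∂(Measure.dirac (shearState M hM 1)), ‖u‖ ≤ (1 : ℝ) := by
  haveI : MeasurableSingletonClass H3 := OpensMeasurableSpace.toMeasurableSingletonClass
  rw [ae_dirac_eq]
  simpa using norm_shearState_one_le hM

/-- **The common contradiction.** The Dirac law at the shear mode ONE SHELL ABOVE `κ 0` is not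
`κ`-resolved at tolerance `1` (`n = 0`): its enstrophy `2π²(κ 0 + 1)² ≥ 2π² > 1` lies entirely above the
cutoff `κ 0`, where the truncated enstrophy is `0`. [folklore] -/
theorem not_isResolved_dirac_shearState (κ : ℕ → ℕ) :
    ¬ IsResolved κ (Measure.dirac (shearState (κ 0 + 1) (Nat.succ_ne_zero _) 1)) 0 := by
  haveI : MeasurableSingletonClass H3 := OpensMeasurableSpace.toMeasurableSingletonClass
  intro h
  unfold IsResolved at h
  rw [lintegral_dirac, lintegral_dirac, eGradNormSq_shearState,
    eGradNormSq_fourierTruncate_shearState _ (Nat.lt_succ_self _)] at h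
  simp only [Nat.cast_zero, zero_add, inv_one, one_pow, mul_one, ENNReal.ofReal_le_one] at h
  push_cast at h
  have hpi : (9 : ℝ) < Real.pi ^ 2 := by nlinarith [Real.pi_gt_three]
  nlinarith [(Nat.cast_nonneg (κ 0) : (0 : ℝ) ≤ κ 0), sq_nonneg ((κ 0 : ℝ))]

/-- **`0 < ν` is load-bearing.** At `ν = 0` (Galerkin Euler, `f = 0`, `R = 1`) every shear mode
`K_{M,1}` is an exact steady state at every level `N ≥ M`, with energy `1/2` and enstrophy `2π²M²` on the
shell `M`: no schedule resolves `δ_{K_{κ 0 + 1, 1}}`. (Physically: no viscosity, no dissipation scale.)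
(The refuted statement — WEAKENING 1 — `ResolvedDissipation` with `0 < ν` weakened to `0 ≤ ν` (all else verbatim).) [folklore] -/
theorem resolvedDissipation_false_without_nu_pos :
    ¬ (∀ f : T3 → R3, Torus.IsSmooth f → Torus.IsDivFree f → Torus.HasZeroMean f →
        ∀ ν : ℝ, 0 ≤ ν → ∀ R : ℝ, ∃ κ : ℕ → ℕ, ∀ (N : ℕ) (μ : Measure H3), IsProbabilityMeasure μ →
          (∀ᵐ u ∂μ, IsLevel N u) → (∀ᵐ u ∂μ, ‖u‖ ≤ R) → IsStationary ν f N μ → ∀ n, IsResolved κ μ n) := by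
  intro h
  obtain ⟨κ, hκ⟩ := h 0 isSmooth_zero isDivFree_zero hasZeroMean_zero 0 le_rfl 1
  exact not_isResolved_dirac_shearState κ (hκ (κ 0 + 1) _ inferInstance
    (ae_isLevel_dirac_shearState _ 1 le_rfl) (ae_norm_le_dirac_shearState _)
    (isStationary_dirac_shearState_euler _ 1 _) 0)

/-- **Stationarity is load-bearing.** Without it, `δ_{K_{κ 0 + 1, 1}}` (level `κ 0 + 1`, unit ball) is an
admissible law at `ν = 1`, unresolved. A proof must use the invariance of `μ` under the Galerkin flow
(the only hypothesis linking `μ` to `ν` and `f`).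
(The refuted statement — WEAKENING 2 — `ResolvedDissipation` without the stationarity hypothesis (all else verbatim).) [folklore] -/
theorem resolvedDissipation_false_without_stationarity :
    ¬ (∀ f : T3 → R3, Torus.IsSmooth f → Torus.IsDivFree f → Torus.HasZeroMean f →
        ∀ ν : ℝ, 0 < ν → ∀ R : ℝ, ∃ κ : ℕ → ℕ, ∀ (N : ℕ) (μ : Measure H3), IsProbabilityMeasure μ →
          (∀ᵐ u ∂μ, IsLevel N u) → (∀ᵐ u ∂μ, ‖u‖ ≤ R) → ∀ n, IsResolved κ μ n) := by
  intro h
  obtain ⟨κ, hκ⟩ := h 0 isSmooth_zero isDivFree_zero hasZeroMean_zero 1 one_pos 1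
  exact not_isResolved_dirac_shearState κ (hκ (κ 0 + 1) _ inferInstance
    (ae_isLevel_dirac_shearState _ 1 le_rfl) (ae_norm_le_dirac_shearState _) 0)

/-- **The level clause is load-bearing.** Without it the law may live above the tests: at `ν = 1`,
`f = 0`, level `N = 0` (or any `N ≤ κ 0`), the decaying mode `δ_{K_{κ 0 + 1, 1}}` passes every level-`N`
row (it is invisible to them) and is unresolved. So a proof must use that `μ` is carried by the SAME
Galerkin space the tests generate (stationarity for band-limited tests = Liouville only on level-`N` laws).
(The refuted statement — WEAKENING 3 — `ResolvedDissipation` without the level clause `∀ᵐ u ∂μ, û = 0 off 0 < |k| ≤ N` on the law (the tests stay band-limited at level `N`; all else verbatim).) [folklore] -/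
theorem resolvedDissipation_false_without_level :
    ¬ (∀ f : T3 → R3, Torus.IsSmooth f → Torus.IsDivFree f → Torus.HasZeroMean f →
        ∀ ν : ℝ, 0 < ν → ∀ R : ℝ, ∃ κ : ℕ → ℕ, ∀ (N : ℕ) (μ : Measure H3), IsProbabilityMeasure μ →
          (∀ᵐ u ∂μ, ‖u‖ ≤ R) → IsStationary ν f N μ → ∀ n, IsResolved κ μ n) := by
  intro h
  obtain ⟨κ, hκ⟩ := h 0 isSmooth_zero isDivFree_zero hasZeroMean_zero 1 one_pos 1
  exact not_isResolved_dirac_shearState κ (hκ 0 _ inferInstance (ae_norm_le_dirac_shearState _)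
    (isStationary_dirac_shearState_of_lt _ 1 1 (Nat.succ_pos _)) 0)

end LoadBearing

/-! ## §4 Refuted strengthening: the schedule cannot be uniform in the force

`κ` depends on `f` through its spectral support, not through `ν`, `R` or an energy budget: the laminar
single-mode steady states `K_{M,1}` (force `4π²νM² K_{M,1}`, energy `1/2`, unit ball) carry enstrophy
`2π²M²` on the shell `M`, for every `M`. -/

section UniformInForce

/-- The laminar Dirac `δ_{K_{M,a}}` is stationary at EVERY level for the force `4π²νM² K_{M,a}`. [folklore] -/
theorem isStationary_dirac_shearState_laminar {M : ℕ} (hM : M ≠ 0) (a ν : ℝ) (N : ℕ) :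
    IsStationary ν (shearField M (4 * Real.pi ^ 2 * ν * (M : ℝ) ^ 2 * a)) N (Measure.dirac (shearState M hM a)) := by
  haveI : MeasurableSingletonClass H3 := OpensMeasurableSpace.toMeasurableSingletonClass
  intro m g P hg
  refine ⟨Torus.integrable_dirac _ _, ?_⟩
  rw [integral_dirac]
  exact nsGeneratorPairing_shearField (coe_shearState_ae hM a)
    (Torus.isSmooth_sum_smul Finset.univ _ fun i _ => (hg i).1)

/-- **No force-uniform schedule** (`ν = 1`, `R = 1`): given `κ`, the force `4π²M² K_{M,1}` with
`M = κ 0 + 1` has the unresolved invariant law `δ_{K_{M,1}}` at level `M`. The schedule of the crux must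
see the spectral tail of `f` (here: of `P_N f`), not just `‖f‖`, `ν`, `R`.
(The refuted statement — STRENGTHENING 1 — one schedule for ALL smooth forces at fixed `(ν, R)` (`∃ κ` moved before `∀ f`).) [folklore] -/
theorem not_resolvedDissipationUniformInForce :
    ¬ (∀ ν : ℝ, 0 < ν → ∀ R : ℝ, ∃ κ : ℕ → ℕ, ∀ f : T3 → R3, Torus.IsSmooth f → Torus.IsDivFree f →
        Torus.HasZeroMean f → ∀ (N : ℕ) (μ : Measure H3), IsProbabilityMeasure μ →
          (∀ᵐ u ∂μ, IsLevel N u) → (∀ᵐ u ∂μ, ‖u‖ ≤ R) → IsStationary ν f N μ → ∀ n, IsResolved κ μ n) := by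
  intro h
  obtain ⟨κ, hκ⟩ := h 1 one_pos 1
  have hM : κ 0 + 1 ≠ 0 := Nat.succ_ne_zero _
  exact not_isResolved_dirac_shearState κ (hκ _ (isSmooth_shearField _ _) (isDivFree_shearField _ _)
    (hasZeroMean_shearField hM _) (κ 0 + 1) _ inferInstance (ae_isLevel_dirac_shearState _ 1 le_rfl)
    (ae_norm_le_dirac_shearState _) (isStationary_dirac_shearState_laminar hM 1 1 _) 0)

end UniformInForce



end Summit.AnomalousDissipation.AnomalousDissipation.Theorems.ResolvedDissipation.Negative
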